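import Mathlib
import HarnessLib
import Summits.PneNP.PneNP.Theorems.AeaCutRectanglesDutyRectangles

/-!
# Route AeaCutRectangles — crux `FoolingMeasure` (stmt-PneNP-19727): THE FIBRE BOUND (necessary condition N1)

The cheapest cut rectangles inside NON-3-COL over a cut `B` are the FIBRE rectangles: fix ONE inside part
`β₀` (Bob's labelled graph) and take every loopless outside part `α` with `α ∪ β₀` non-3-colourable.  Its mass
under a measure supported on loopless non-3-colourable edge sets is the whole mass of the Bob-fibre
`{G : G[B] = β₀}` (`bobFibre_sum_le_rect`).  Hence (`bobFibre_le_of_rectClause`) X1's rectangle clause at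
`B` with bound `δ` forces EVERY Bob-fibre — and symmetrically (`aliceFibre_le_of_rectClause`) every
Alice-fibre `{G : G ∖ G[B] = α₀}` — to have mass `≤ δ`: both sides of every near-balanced cut must carry
min-entropy `≥ (n/2)·log₂ n + C·n` (WITNESS-g1 §5 "N1"; the refuter's `pointMass` lemma is the special case of
a point).  `AeaCutRectanglesOrbitMeasures` evaluates the Bob-fibre of an orbit measure (`≥ (n-|B|)!/n!`).

HONEST FRAMING: bookkeeping; FRONTIER material for a rung of Fagin's complement ladder; nothing here bears on
P vs NP.
-/

set_option linter.dupNamespace false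
set_option autoImplicit false

namespace Summit.PneNP.PneNP.Theorems.AeaCutRectanglesFibreBound

open Finset
open Summit.PneNP.PneNP.Theorems.AeaCutRectanglesDutyRectangles

variable {V : Type*} [Fintype V] [DecidableEq V]

/-- The BOB-FIBRE of `β₀` over `B`: the edge sets whose inside part is exactly `β₀`. -/
def bobFibre (B : Finset V) (β₀ : Finset (Sym2 V)) : Finset (Finset (Sym2 V)) :=
  univ.filter fun G => bobSide B G = β₀

/-- The ALICE-FIBRE of `α₀` over `B`: the edge sets whose outside-meeting part is exactly `α₀`. -/
def aliceFibre (B : Finset V) (α₀ : Finset (Sym2 V)) : Finset (Finset (Sym2 V)) :=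
  univ.filter fun G => aliceSide B G = α₀

/-- Membership in a Bob-fibre. -/
theorem mem_bobFibre {B : Finset V} {β₀ G : Finset (Sym2 V)} : G ∈ bobFibre B β₀ ↔ bobSide B G = β₀ := by
  simp [bobFibre]

/-- Membership in an Alice-fibre. -/
theorem mem_aliceFibre {B : Finset V} {α₀ G : Finset (Sym2 V)} :
    G ∈ aliceFibre B α₀ ↔ aliceSide B G = α₀ := by
  simp [aliceFibre]

/-- **The Bob-fibre rectangle.**  For a function `μ` supported on loopless non-3-colourable edge sets, a cut
`B` and an inside part `β₀`, there is a cut rectangle over `B` inside NON-3-COL (X1's three hypotheses) whose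
mass is at least the `μ`-mass of the Bob-fibre of `β₀`. -/
theorem bobFibre_sum_le_rect (μ : Finset (Sym2 V) → ℝ)
    (hs : ∀ S, μ S ≠ 0 → (∀ e ∈ S, ¬ e.IsDiag) ∧
      ¬ (SimpleGraph.fromEdgeSet (S : Set (Sym2 V))).Colorable 3)
    (B : Finset V) (β₀ : Finset (Sym2 V)) :
    ∃ 𝓐 𝓑 : Finset (Finset (Sym2 V)),
      (∀ α ∈ 𝓐, ∀ e ∈ α, ¬ e.IsDiag ∧ ∃ v ∈ e, v ∉ B) ∧
      (∀ β ∈ 𝓑, ∀ e ∈ β, ¬ e.IsDiag ∧ ∀ v ∈ e, v ∈ B) ∧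
      (∀ α ∈ 𝓐, ∀ β ∈ 𝓑,
        ¬ (SimpleGraph.fromEdgeSet ((α ∪ β : Finset (Sym2 V)) : Set (Sym2 V))).Colorable 3) ∧
      ∑ G ∈ bobFibre B β₀, μ G ≤ ∑ q ∈ 𝓐 ×ˢ 𝓑, μ (q.1 ∪ q.2) := by
  classical
  -- the members of the fibre that carry mass
  set F : Finset (Finset (Sym2 V)) := (bobFibre B β₀).filter fun G => μ G ≠ 0 with hF
  by_cases hFe : F = ∅
  · -- no mass in the fibre: the empty rectangle works
    refine ⟨∅, ∅, by simp, by simp, by simp, ?_⟩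
    have hzero : ∑ G ∈ bobFibre B β₀, μ G = 0 := by
      refine sum_eq_zero fun G hG => ?_
      by_contra hne
      have : G ∈ F := mem_filter.2 ⟨hG, hne⟩
      rw [hFe] at this
      exact absurd this (Finset.notMem_empty G)
    rw [hzero]
    simp
  · -- some member carries mass, so `β₀` is a loopless inside part
    obtain ⟨G₀, hG₀⟩ := Finset.nonempty_iff_ne_empty.2 hFe
    obtain ⟨hG₀F, hG₀μ⟩ := mem_filter.1 hG₀
    have hβ₀ : ∀ e ∈ β₀, ¬ e.IsDiag ∧ ∀ v ∈ e, v ∈ B := by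
      intro e he
      rw [← mem_bobFibre.1 hG₀F] at he
      obtain ⟨heG, hin⟩ := mem_bobSide.1 he
      exact ⟨(hs G₀ hG₀μ).1 e heG, hin⟩
    set 𝓐 : Finset (Finset (Sym2 V)) := F.image (aliceSide B) with h𝓐
    refine ⟨𝓐, {β₀}, ?_, ?_, ?_, ?_⟩
    · intro α hα e he
      obtain ⟨G, hG, rfl⟩ := mem_image.1 hα
      obtain ⟨heG, hout⟩ := mem_aliceSide.1 he
      exact ⟨(hs G (mem_filter.1 hG).2).1 e heG, hout⟩
    · intro β hβ
      rw [mem_singleton] at hβ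
      subst hβ
      exact hβ₀
    · intro α hα β hβ
      rw [mem_singleton] at hβ
      subst hβ
      obtain ⟨G, hG, rfl⟩ := mem_image.1 hα
      obtain ⟨hGF, hGμ⟩ := mem_filter.1 hG
      rw [← mem_bobFibre.1 hGF, aliceSide_union_bobSide]
      exact (hs G hGμ).2
    · -- ∑ over the fibre = ∑ over F = ∑ over 𝓐 ×ˢ {β₀}
      have hsplit : ∑ G ∈ bobFibre B β₀, μ G = ∑ G ∈ F, μ G := by
        rw [hF, sum_filter]
        refine sum_congr rfl fun G _ => ?_
        by_cases h : μ G ≠ 0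
        · rw [if_pos h]
        · rw [if_neg h]
          push Not at h
          exact h
      have hinj : ∀ G ∈ F, ∀ G' ∈ F, aliceSide B G = aliceSide B G' → G = G' := by
        intro G hG G' hG' h
        rw [← aliceSide_union_bobSide B G, ← aliceSide_union_bobSide B G', h,
          mem_bobFibre.1 (mem_filter.1 hG).1, mem_bobFibre.1 (mem_filter.1 hG').1]
      rw [hsplit, sum_product]
      simp only [sum_singleton]
      rw [h𝓐, sum_image hinj]
      refine le_of_eq (sum_congr rfl fun G hG => ?_)
      rw [← mem_bobFibre.1 (mem_filter.1 hG).1, aliceSide_union_bobSide]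

/-- **N1 (Bob side).**  X1's rectangle clause at the cut `B` with bound `δ` forces every Bob-fibre to have
mass `≤ δ`. -/
theorem bobFibre_le_of_rectClause (μ : Finset (Sym2 V) → ℝ)
    (hs : ∀ S, μ S ≠ 0 → (∀ e ∈ S, ¬ e.IsDiag) ∧
      ¬ (SimpleGraph.fromEdgeSet (S : Set (Sym2 V))).Colorable 3)
    {B : Finset V} {δ : ℝ}
    (hclause : ∀ 𝓐 𝓑 : Finset (Finset (Sym2 V)),
      (∀ α ∈ 𝓐, ∀ e ∈ α, ¬ e.IsDiag ∧ ∃ v ∈ e, v ∉ B) →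
      (∀ β ∈ 𝓑, ∀ e ∈ β, ¬ e.IsDiag ∧ ∀ v ∈ e, v ∈ B) →
      (∀ α ∈ 𝓐, ∀ β ∈ 𝓑,
        ¬ (SimpleGraph.fromEdgeSet ((α ∪ β : Finset (Sym2 V)) : Set (Sym2 V))).Colorable 3) →
      ∑ q ∈ 𝓐 ×ˢ 𝓑, μ (q.1 ∪ q.2) ≤ δ)
    (β₀ : Finset (Sym2 V)) : ∑ G ∈ bobFibre B β₀, μ G ≤ δ := by
  obtain ⟨𝓐, 𝓑, h𝓐, h𝓑, hN, hle⟩ := bobFibre_sum_le_rect μ hs B β₀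
  exact hle.trans (hclause 𝓐 𝓑 h𝓐 h𝓑 hN)

/-- **The Alice-fibre rectangle** (symmetric statement: one outside part, all compatible inside parts). -/
theorem aliceFibre_sum_le_rect (μ : Finset (Sym2 V) → ℝ)
    (hs : ∀ S, μ S ≠ 0 → (∀ e ∈ S, ¬ e.IsDiag) ∧
      ¬ (SimpleGraph.fromEdgeSet (S : Set (Sym2 V))).Colorable 3)
    (B : Finset V) (α₀ : Finset (Sym2 V)) :
    ∃ 𝓐 𝓑 : Finset (Finset (Sym2 V)),
      (∀ α ∈ 𝓐, ∀ e ∈ α, ¬ e.IsDiag ∧ ∃ v ∈ e, v ∉ B) ∧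
      (∀ β ∈ 𝓑, ∀ e ∈ β, ¬ e.IsDiag ∧ ∀ v ∈ e, v ∈ B) ∧
      (∀ α ∈ 𝓐, ∀ β ∈ 𝓑,
        ¬ (SimpleGraph.fromEdgeSet ((α ∪ β : Finset (Sym2 V)) : Set (Sym2 V))).Colorable 3) ∧
      ∑ G ∈ aliceFibre B α₀, μ G ≤ ∑ q ∈ 𝓐 ×ˢ 𝓑, μ (q.1 ∪ q.2) := by
  classical
  set F : Finset (Finset (Sym2 V)) := (aliceFibre B α₀).filter fun G => μ G ≠ 0 with hF
  by_cases hFe : F = ∅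
  · refine ⟨∅, ∅, by simp, by simp, by simp, ?_⟩
    have hzero : ∑ G ∈ aliceFibre B α₀, μ G = 0 := by
      refine sum_eq_zero fun G hG => ?_
      by_contra hne
      have : G ∈ F := mem_filter.2 ⟨hG, hne⟩
      rw [hFe] at this
      exact absurd this (Finset.notMem_empty G)
    rw [hzero]
    simp
  · obtain ⟨G₀, hG₀⟩ := Finset.nonempty_iff_ne_empty.2 hFe
    obtain ⟨hG₀F, hG₀μ⟩ := mem_filter.1 hG₀
    have hα₀ : ∀ e ∈ α₀, ¬ e.IsDiag ∧ ∃ v ∈ e, v ∉ B := by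
      intro e he
      rw [← mem_aliceFibre.1 hG₀F] at he
      obtain ⟨heG, hout⟩ := mem_aliceSide.1 he
      exact ⟨(hs G₀ hG₀μ).1 e heG, hout⟩
    set 𝓑 : Finset (Finset (Sym2 V)) := F.image (bobSide B) with h𝓑
    refine ⟨{α₀}, 𝓑, ?_, ?_, ?_, ?_⟩
    · intro α hα
      rw [mem_singleton] at hα
      subst hα
      exact hα₀
    · intro β hβ e he
      obtain ⟨G, hG, rfl⟩ := mem_image.1 hβ
      obtain ⟨heG, hin⟩ := mem_bobSide.1 he
      exact ⟨(hs G (mem_filter.1 hG).2).1 e heG, hin⟩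
    · intro α hα β hβ
      rw [mem_singleton] at hα
      subst hα
      obtain ⟨G, hG, rfl⟩ := mem_image.1 hβ
      obtain ⟨hGF, hGμ⟩ := mem_filter.1 hG
      rw [← mem_aliceFibre.1 hGF, aliceSide_union_bobSide]
      exact (hs G hGμ).2
    · have hsplit : ∑ G ∈ aliceFibre B α₀, μ G = ∑ G ∈ F, μ G := by
        rw [hF, sum_filter]
        refine sum_congr rfl fun G _ => ?_
        by_cases h : μ G ≠ 0
        · rw [if_pos h]
        · rw [if_neg h]
          push Not at h
          exact h
      have hinj : ∀ G ∈ F, ∀ G' ∈ F, bobSide B G = bobSide B G' → G = G' := by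
        intro G hG G' hG' h
        rw [← aliceSide_union_bobSide B G, ← aliceSide_union_bobSide B G', h,
          mem_aliceFibre.1 (mem_filter.1 hG).1, mem_aliceFibre.1 (mem_filter.1 hG').1]
      rw [hsplit, sum_product, sum_singleton, h𝓑, sum_image hinj]
      refine le_of_eq (sum_congr rfl fun G hG => ?_)
      rw [← mem_aliceFibre.1 (mem_filter.1 hG).1, aliceSide_union_bobSide]

/-- **N1 (Alice side).**  X1's rectangle clause at `B` with bound `δ` forces every Alice-fibre to have mass `≤ δ`. -/
theorem aliceFibre_le_of_rectClause (μ : Finset (Sym2 V) → ℝ)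
    (hs : ∀ S, μ S ≠ 0 → (∀ e ∈ S, ¬ e.IsDiag) ∧
      ¬ (SimpleGraph.fromEdgeSet (S : Set (Sym2 V))).Colorable 3)
    {B : Finset V} {δ : ℝ}
    (hclause : ∀ 𝓐 𝓑 : Finset (Finset (Sym2 V)),
      (∀ α ∈ 𝓐, ∀ e ∈ α, ¬ e.IsDiag ∧ ∃ v ∈ e, v ∉ B) →
      (∀ β ∈ 𝓑, ∀ e ∈ β, ¬ e.IsDiag ∧ ∀ v ∈ e, v ∈ B) →
      (∀ α ∈ 𝓐, ∀ β ∈ 𝓑,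
        ¬ (SimpleGraph.fromEdgeSet ((α ∪ β : Finset (Sym2 V)) : Set (Sym2 V))).Colorable 3) →
      ∑ q ∈ 𝓐 ×ˢ 𝓑, μ (q.1 ∪ q.2) ≤ δ)
    (α₀ : Finset (Sym2 V)) : ∑ G ∈ aliceFibre B α₀, μ G ≤ δ := by
  obtain ⟨𝓐, 𝓑, h𝓐, h𝓑, hN, hle⟩ := aliceFibre_sum_le_rect μ hs B α₀
  exact hle.trans (hclause 𝓐 𝓑 h𝓐 h𝓑 hN)

end Summit.PneNP.PneNP.Theorems.AeaCutRectanglesFibreBound
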